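import Summits.MatrixMultiplication.MatrixMultiplication.Theorems.SoloInformedTransfer

/-!
# The transpose involution of a realization: `8.20′` is `8.20` for the transposed data

This work, §8.8 (T13) and C3-m2 §5 (gen 108: the kernel glue). Setting: a CU13-Def-12 realization of
`⟨n,n,n⟩` in `𝒮(S⁰ × S¹, ±)` [CohnUmans2013, arXiv:1207.6528, Def. 12] — equation data `D : Data ι G`, a chart
`Φ = (f, g, l)`, full separation.

The separation relation is NOT cyclically symmetric in `(i, j, k)`, but it IS symmetric under the involution
exchanging the roles of `i` and `k`: `D† := (a† k j := b j k, b† j i := a i j, c† i k := c k i)` is again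
equation data (the sign patterns are permuted), the chart `Φ† := (l, −g, f)` has the same fibres up to the swap,
and full separation transfers (`Data.sepAll_transpose`). Row `j` of `b†` is column `j` of `a` and column `j` of
`a†` is row `j` of `b` — so every statement about poor/rich ROWS of `b` yields the mirror statement about
poor/rich COLUMNS of `a` for free (THEOREM 8.20′ from THEOREM 8.20, the mirror halves of THEOREM 8.22).
-/

namespace Summit.MatrixMultiplication.MatrixMultiplication.Theorems.TwistedTPP

namespace FibreLines

variable {ι G : Type*} [AddCommGroup G]

/-- The four separation patterns are invariant under exchanging the first two cells (up to the signs of the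
patterns). -/
theorem sep_patterns_swap {x y z : G} :
    (y + x + z ≠ 0 ∧ y + x - z ≠ 0 ∧ y - x + z ≠ 0 ∧ y - x - z ≠ 0) ↔
      (x + y + z ≠ 0 ∧ x + y - z ≠ 0 ∧ x - y + z ≠ 0 ∧ x - y - z ≠ 0) := by
  have e1 : y + x + z = x + y + z := by abel
  have e2 : y + x - z = x + y - z := by abel
  have e3 : y - x + z = -(x - y - z) := by abel
  have e4 : y - x - z = -(x - y + z) := by abel
  rw [e1, e2, e3, e4, neg_ne_zero, neg_ne_zero]
  tauto

/-- **The transposed equation data** `D† = (bᵀ, aᵀ, cᵀ)` with the roles of `i` and `k` exchanged: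
`a† k j = b j k`, `b† j i = a i j`, `c† i k = c k i`. -/
def Data.transpose (D : Data ι G) : Data ι G where
  a k j := D.b j k
  b j i := D.a i j
  c i k := D.c k i
  eqn I J K := by
    rcases D.eqn K J I with h | h | h | h
    · exact Or.inl (((by abel) : D.b J I + D.a K J + D.c I K = D.a K J + D.b J I + D.c I K).trans h)
    · exact Or.inr (Or.inl
        (((by abel) : D.b J I + D.a K J - D.c I K = D.a K J + D.b J I - D.c I K).trans h))
    · refine Or.inr (Or.inr (Or.inr ?_))
      have e : D.b J I - D.a K J - D.c I K = -(D.a K J - D.b J I + D.c I K) := by abel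
      rw [e, h, neg_zero]
    · refine Or.inr (Or.inr (Or.inl ?_))
      have e : D.b J I - D.a K J + D.c I K = -(D.a K J - D.b J I - D.c I K) := by abel
      rw [e, h, neg_zero]

/-- `a†(k, j) = b(j, k)`. -/
@[simp] theorem Data.transpose_a (D : Data ι G) (k j : ι) : D.transpose.a k j = D.b j k := rfl

/-- `b†(j, i) = a(i, j)`. -/
@[simp] theorem Data.transpose_b (D : Data ι G) (j i : ι) : D.transpose.b j i = D.a i j := rfl

/-- `c†(i, k) = c(k, i)`. -/
@[simp] theorem Data.transpose_c (D : Data ι G) (i k : ι) : D.transpose.c i k = D.c k i := rfl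

/-- Row `j` of `b†` is column `j` of `a` (as value sets). -/
theorem Data.transpose_b_row [Fintype ι] [DecidableEq G] (D : Data ι G) (j : ι) :
    (Finset.univ.image fun i => D.transpose.b j i) = Finset.univ.image fun i => D.a i j := rfl

/-- Column `j` of `a†` is row `j` of `b` (as value sets). -/
theorem Data.transpose_a_col [Fintype ι] [DecidableEq G] (D : Data ι G) (j : ι) :
    (Finset.univ.image fun k => D.transpose.a k j) = Finset.univ.image fun k => D.b j k := rfl

/-- Separation transposes: `D†.Sep (I,J,K) (I′,J′,K′) ⟺ D.Sep (K,J′,I) (K′,J,I′)`. -/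
theorem Data.transpose_sep (D : Data ι G) (I J K I' J' K' : ι) :
    D.transpose.Sep I J K I' J' K' ↔ D.Sep K J' I K' J I' :=
  sep_patterns_swap (x := D.a K J') (y := D.b J I) (z := D.c I' K')

variable {G₀ : Type*} [AddCommGroup G₀]

/-- **The transposed chart** `Φ† = (l, −g, f)`. -/
def Chart.transpose (Φ : Chart ι G₀) : Chart ι G₀ := ⟨Φ.l, fun j => -Φ.g j, Φ.f⟩

/-- The fibre map of the transposed chart. -/
theorem Chart.transpose_F (Φ : Chart ι G₀) (i j k : ι) :
    Φ.transpose.F i j k = Φ.l i + -Φ.g j + Φ.f k := rfl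

/-- **Full separation transposes.** [this work, §8.8 (T13)] -/
theorem Data.sepAll_transpose (D : Data ι G) {Φ : Chart ι G₀} (hsep : D.SepAll Φ) :
    D.transpose.SepAll Φ.transpose := by
  intro I J K I' J' K' hF hne
  rw [Data.transpose_sep]
  refine hsep K J' I K' J I' ?_ ?_
  · rw [Chart.transpose_F, Chart.transpose_F] at hF
    show Φ.f K + Φ.g J' + Φ.l I = Φ.f K' + Φ.g J + Φ.l I'
    rw [← sub_eq_zero] at hF ⊢
    have e : Φ.f K + Φ.g J' + Φ.l I - (Φ.f K' + Φ.g J + Φ.l I') =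
        Φ.l I + -Φ.g J + Φ.f K - (Φ.l I' + -Φ.g J' + Φ.f K') := by abel
    rw [e]; exact hF
  · intro h
    apply hne
    simp only [Prod.mk.injEq] at h ⊢
    exact ⟨h.2.2, h.2.1.symm, h.1⟩

/-- The transpose is an involution on the data. -/
theorem Data.transpose_transpose (D : Data ι G) : D.transpose.transpose = D := by
  cases D; rfl

end FibreLines

end Summit.MatrixMultiplication.MatrixMultiplication.Theorems.TwistedTPP
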